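import Mathlib
import Literature.MathematicalPhysics.QuantumFieldTheory.Balaban1983to89.Beta.PolarizationWitness

/-!
# `Balaban1983to89.Beta.PolarizationWitnessZd` — the `ℤ^d` INSTANCE of the non-vacuity witness: the explicit
# infinite-volume Maxwell kernel is the `IsInfiniteVolumeLimit` of the torus Maxwell kernels with volume-UNIFORM
# finite-range decay, so EVERY hypothesis of `PolarizationLimit.secondMoment_nonneg_of_limit` is discharged at once,
# and the (1.22)-shaped second moment of the limit kernel is exactly `2`

T. Bałaban, *Renormalization group approach to lattice gauge field theories. I. Generation of effective actions in a
small field approximation and a coupling constant renormalization in four dimensions*, Commun. Math. Phys. **109**,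
249–301 (1987) [Balaban1987RG1] (cell paper B12; PDF page = journal page − 248; PDF held:
`paper:balaban1987-cmp109-rg-i-small-field`).

HONEST FRAMING (BETA-SPEC.md, verbatim): discharging `BetaPertH` makes Bałaban's UV stability UNCONDITIONAL — a real
constructive-QFT result; it is NOT the continuum limit and NOT the Clay problem.  THIS MODULE DISCHARGES NOTHING of the
series.  It is KERNEL-CHECKED BOOKKEEPING (unit `b2b-balaban-pv09` gen 8, journal node
`BETA-an2-LEMMA52-WITNESS-ZD-KERNEL`, the follow-up (k6) of node (k5) = `Beta/PolarizationWitness.lean`, recorded there,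
SCOPE (b), as "NOT done in this node"): finite-range lattice calculus pushed through pv01's window dictionary
(`Beta/InfiniteVolume.lean`).  Value = a certificate that the FULL hypothesis list of the β sub-cell's sign assembly
`PolarizationLimit.secondMoment_nonneg_of_limit` — sides `→ ∞`, pv25's `IsInfiniteVolumeLimit` ((1.21) predicate),
pv01's `UniformDecay` (the located unprinted input of GAPS G-beta-4), and eventually-in-the-volume torus Ward / PSD /
reflection covariance — is JOINTLY SATISFIABLE by one explicit non-zero kernel, with the conclusion attained STRICTLY
(`β = 2 > 0`), so that theorem is neither vacuous nor `β = 0` in disguise — NOT summit progress.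

CITATION HEADER (lean-in-tree rule 2026-08-18).  NO NEW QUOTATION is introduced by this module, and NOTHING PRINTED IS
ASSERTED.  The printed sentences it is ABOUT — p. 264 [PDF 16], after (1.21): the limit `T^{(j+1)} ↗ Z^d` (typed by
pv25 as the PREDICATE `Beta.IsInfiniteVolumeLimit`, `Beta/OneLoop.lean`), (1.22) (the second moment
`Σ_x Π_{μν}(x) x_μ x_ν`, `μ ≠ ν`, typed as `B12Beta.secondMoment`; torus proxy `Beta.torusSecondMoment`), and p. 293
[PDF 45], (5.7)–(5.10) (typed as the `ℤ^d` PREDICATES `AxisReflectionCovariant`, `IndexSymmetric`, `WardTransversal`,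
`B12Sec2to5.Decay510` / `MomentSummable` in `Beta/PolarizationSign.lean`, node (k3), and as their torus-side images in
`Beta/PolarizationLimit.lean`, node (k4); the volume-uniform form of (5.10) is pv01's hypothesis `Beta.UniformDecay`,
`Beta/InfiniteVolume.lean`) — are quoted verbatim in the headers of those modules and are used here BY NAME only.  The
objects introduced below (the Kronecker delta on `ℤ^d`, the explicit finite-range kernel `maxwellKernelZ` = the closed
form `2([μ=ν] Σ_κ C_{κκ} − C_{νμ})` of (k5)'s `maxwellKernel_apply` with `ℤ^d` deltas) are FOLKLORE lattice calculus,
defined from scratch and tagged `[folklore]`; that this kernel is "the `g → 0` term of Bałaban's `Π_{μν}(g_k,·)`" is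
CONTEXT from the β sub-cell's notes (`HOME/BETA/AN2-pv09.md` §9 — programme-internal prose, NOT cited as a source of
facts, cell rule) and is NOT asserted or used: every theorem below is an unconditional statement about explicitly
defined kernels.

WHAT IS PROVED (0 sorry; Mathlib + the cell modules imported, all by name):
(1) §1 `zdelta`, `zddCorr ν μ z = δ(z + e_μ − e_ν) − δ(z − e_ν) − δ(z + e_μ) + δ(z)` and the explicit kernel
    `maxwellKernelZ d : B12Beta.Kernel d`, `Π^ℤ_{μν}(z) = 2([μ=ν] Σ_κ C_{κκ}(z) − C_{νμ}(z))`; the sanity values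
    `maxwellKernelZ_transverse : Π^ℤ_{μν}(e_ν − e_μ) = −2` (`μ ≠ ν`; the kernel is not zero).
(2) §2 THE WINDOW DICTIONARY FOR DELTAS: `delta0_siteOf` (`δ_T(siteOf y) = δ_ℤ(y)` for `y` in pv01's window),
    `ddCorr_siteOf`, and `maxwellKernel_siteOf : maxwellKernel d s μ ν (siteOf d s z) = maxwellKernelZ d μ ν z` as soon as
    `2|z_i| + 4 < s` for all `i` (the torus kernel READ THROUGH THE RESIDUE MAP equals the `ℤ^d` kernel on a window
    shrunk by the range `2` of the kernel; `siteOf` additivity is pv04's `Beta/VolumeAffine.lean` /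
    `Beta/VolumeConvolution.lean`, window injectivity pv01's `eq_of_inWindow_of_intCast_eq`).
(3) §3 `isInfiniteVolumeLimit_maxwellKernel : Tendsto side atTop atTop → IsInfiniteVolumeLimit side
    (fun t => maxwellKernel d (side t)) (maxwellKernelZ d)` — eventual EQUALITY, hence convergence, at every `x ∈ ℤ^d`.
(4) §4 VOLUME-UNIFORM FINITE-RANGE DECAY: `abs_symmRep_intCast_le : |symmRep s k| ≤ |k|` (the symmetric representative
    is the shortest), `l1_windowMap_siteOf_le`, `delta0_sub_siteOf_le` (a delta supported at a point of window-size `≤ 2`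
    is `≤ e^{2δ} e^{−δ|x|₁}`), `abs_ddCorr_le`, `abs_maxwellKernel_le : |maxwellKernel d s μ ν x| ≤ 8(d+1)e^{2δ}
    e^{−δ|windowMap x|₁}` for EVERY period `s ≥ 1` and every `δ ≥ 0`, i.e. `uniformDecay_maxwellKernel :
    UniformDecay side (fun t => maxwellKernel d (side t)) (8(d+1)e^{2δ}) δ` for EVERY sequence of sides.
(5) §5 ASSEMBLY — every hypothesis of (k4) discharged: `secondMoment_maxwellKernelZ_nonneg_of_limit` (=
    `PolarizationLimit.secondMoment_nonneg_of_limit` applied to (3), (4) with `δ = 1`, and (k5)'s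
    `maxwellKernel_hypotheses` at every volume) : `0 ≤ B12Beta.secondMoment (maxwellKernelZ d) α β` (`α ≠ β`), for any
    sides `→ ∞`; the `ℤ^d` predicates of (k3) for the limit kernel — `wardTransversal_maxwellKernelZ`,
    `axisReflectionCovariant_maxwellKernelZ`, `indexSymmetric_maxwellKernelZ`, `convPSD_maxwellKernelZ`,
    `decay510_maxwellKernelZ`, `momentSummable_maxwellKernelZ` — all UNCONDITIONAL (via the `_of_limit` transfer
    theorems of (k4) / pv01 along the sides `t + 1`).
(6) §6 THE VALUE: `tendsto_torusSecondMoment_maxwellKernel` (pv01's `tendsto_torusSecondMoment`, hypotheses discharged)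
    and `secondMoment_maxwellKernelZ : B12Beta.secondMoment (maxwellKernelZ d) μ ν = 2` (`μ ≠ ν`) — by UNIQUENESS OF
    LIMITS from (k5)'s finite-volume evaluation `torusSecondMoment_maxwellKernel = 2` (`s ≥ 3`): no `tsum` is evaluated
    by hand; the infinite-volume number is READ OFF the torus numbers through the dictionary, which is exactly the
    logical shape in which the β sub-cell intends finite-volume information to reach (1.22).
SCOPE.  (a) Nothing about BAŁABAN's kernels `Π_{μν}(g_k,·)` / the one-loop torus kernels `torusKernel (D.model k t) a`
is asserted: whether THEY satisfy `IsInfiniteVolumeLimit` (G-adv2-2), `UniformDecay` (G-beta-4) and the torus-side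
predicates is the β sub-cell's analysis, untouched here.  (b) No claim about `β⁰_k`, (AF-0), `BetaPertH` or G1 is made
or implied; `2` is the second moment of the TREE-LEVEL witness kernel of (k5), not a coefficient of Bałaban's
β-function.  (c) The witness works in every dimension `d` (the statements with `α ≠ β` are empty for `d ≤ 1`).
-/

namespace Literature.MathematicalPhysics.QuantumFieldTheory.Balaban1983to89.Beta.PolarizationWitnessZd

open Literature.MathematicalPhysics.QuantumFieldTheory.Balaban1983to89
open Literature.MathematicalPhysics.QuantumFieldTheory.Balaban1983to89.Beta
open Literature.MathematicalPhysics.QuantumFieldTheory.Balaban1983to89.Beta.PolarizationSign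
open Literature.MathematicalPhysics.QuantumFieldTheory.Balaban1983to89.Beta.PolarizationLimit
open Literature.MathematicalPhysics.QuantumFieldTheory.Balaban1983to89.Beta.PolarizationWitness
open Literature.MathematicalPhysics.QuantumFieldTheory.Balaban1983to89.B6BondElimination (unitVec unitVec_apply)
open _root_.Filter
open scoped _root_.Topology

attribute [local simp] Literature.MathematicalPhysics.QuantumFieldTheory.Balaban1983to89.B6BondElimination.unitVec_apply

variable {d : ℕ}

/-! ## §1 The explicit `ℤ^d` Maxwell kernel -/

/-- Kronecker delta at the origin of `ℤ^d`. [folklore] -/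
def zdelta (y : Fin d → ℤ) : ℝ := if y = 0 then 1 else 0

/-- `δ_ℤ(0) = 1`. [folklore] -/
@[simp] theorem zdelta_zero : zdelta (0 : Fin d → ℤ) = 1 := if_pos rfl

/-- `δ_ℤ(y) = 0` for `y ≠ 0`. [folklore] -/
theorem zdelta_of_ne {y : Fin d → ℤ} (h : y ≠ 0) : zdelta y = 0 := if_neg h

/-- `0 ≤ δ_ℤ`. [folklore] -/
theorem zdelta_nonneg (y : Fin d → ℤ) : 0 ≤ zdelta y := by
  unfold zdelta; split_ifs <;> norm_num

/-- The `ℤ^d` difference–difference correlator `C_{νμ}(z) = δ(z + e_μ − e_ν) − δ(z − e_ν) − δ(z + e_μ) + δ(z)` (the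
`ℤ^d` twin of (k5)'s `ddCorr`). [folklore] -/
def zddCorr (ν μ : Fin d) (z : Fin d → ℤ) : ℝ :=
  zdelta (z + unitVec μ - unitVec ν) - zdelta (z - unitVec ν) - zdelta (z + unitVec μ) + zdelta z

/-- **THE EXPLICIT INFINITE-VOLUME MAXWELL KERNEL** on `ℤ^d`: `Π^ℤ_{μν}(z) = 2([μ=ν] Σ_κ C_{κκ}(z) − C_{νμ}(z))`, the
closed form of (k5)'s `maxwellKernel_apply` with `ℤ^d` deltas (the `−Δδ_{μν} + ∂_μ∂_ν^*` structure of the free lattice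
Maxwell operator, doubled). A `B12Beta.Kernel d`. [folklore] -/
def maxwellKernelZ (d : ℕ) : B12Beta.Kernel d :=
  fun μ ν z => 2 * ((if μ = ν then ∑ κ, zddCorr κ κ z else 0) - zddCorr ν μ z)

/-- Unfolding lemma. [folklore] -/
theorem maxwellKernelZ_apply (μ ν : Fin d) (z : Fin d → ℤ) :
    maxwellKernelZ d μ ν z = 2 * ((if μ = ν then ∑ κ, zddCorr κ κ z else 0) - zddCorr ν μ z) := rfl

/-- `e_μ ≠ 0` in `ℤ^d`. [folklore] -/
theorem unitVec_ne_zero (μ : Fin d) : (unitVec μ : Fin d → ℤ) ≠ 0 := by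
  intro h
  have := congrFun h μ
  simp at this

/-- `e_ν − e_μ ≠ 0` for `μ ≠ ν`. [folklore] -/
theorem unitVec_sub_unitVec_ne_zero {μ ν : Fin d} (hμν : μ ≠ ν) : (unitVec ν - unitVec μ : Fin d → ℤ) ≠ 0 := by
  intro h
  have := congrFun h ν
  simp [Ne.symm hμν] at this

/-- SANITY VALUE (the kernel is not zero): `Π^ℤ_{μν}(e_ν − e_μ) = −2` for `μ ≠ ν` — the single point carrying the
off-diagonal second moment. [folklore] -/
theorem maxwellKernelZ_transverse {μ ν : Fin d} (hμν : μ ≠ ν) :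
    maxwellKernelZ d μ ν (unitVec ν - unitVec μ) = -2 := by
  rw [maxwellKernelZ_apply, if_neg hμν, zddCorr]
  have e1 : (unitVec ν - unitVec μ + unitVec μ - unitVec ν : Fin d → ℤ) = 0 := by abel
  have e2 : (unitVec ν - unitVec μ - unitVec ν : Fin d → ℤ) = -unitVec μ := by abel
  have e3 : (unitVec ν - unitVec μ + unitVec μ : Fin d → ℤ) = unitVec ν := by abel
  rw [e1, e2, e3, zdelta_zero, zdelta_of_ne (neg_ne_zero.mpr (unitVec_ne_zero μ)),
    zdelta_of_ne (unitVec_ne_zero ν), zdelta_of_ne (unitVec_sub_unitVec_ne_zero hμν)]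
  ring

/-! ## §2 The window dictionary for deltas: the torus kernel read through `siteOf` is the `ℤ^d` kernel -/

section Window

variable {s : ℕ} [NeZero s]

/-- `0` lies in every window of positive period. [folklore] -/
theorem inWindow_zero : InWindow s 0 :=
  inWindow_of_two_mul_abs_lt (by simpa using Nat.pos_of_ne_zero (NeZero.ne s))

/-- **`δ_T(siteOf y) = δ_ℤ(y)` ON THE WINDOW**: a lattice vector with all coordinates in pv01's window `]−s/2, s/2]`
reduces to `0` mod `s` iff it is `0` (window injectivity, `eq_of_inWindow_of_intCast_eq`). [folklore] -/
theorem delta0_siteOf {y : Fin d → ℤ} (hy : ∀ i, InWindow s (y i)) : delta0 (siteOf d s y) = zdelta y := by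
  by_cases h : y = 0
  · subst h; rw [siteOf_zero, zdelta_zero]; simp [delta0]
  · rw [zdelta_of_ne h]
    have hne : siteOf d s y ≠ 0 := by
      intro h0
      apply h
      funext i
      have hi : ((y i : ℤ) : ZMod s) = ((0 : ℤ) : ZMod s) := by
        have := congrFun h0 i
        simpa [siteOf] using this
      exact eq_of_inWindow_of_intCast_eq (hy i) inWindow_zero hi
    simp [delta0, hne]

omit [NeZero s] in
/-- Coordinates within `2` of a deep-window point are in the window: `2|z_i| + 4 < s`, `|y_i − z_i| ≤ 2` ⇒
`y_i ∈ ]−s/2, s/2]`. [folklore] -/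
theorem inWindow_of_near {z y : Fin d → ℤ} (hz : ∀ i, 2 * |z i| + 4 < (s : ℤ)) (hy : ∀ i, |y i - z i| ≤ 2) (i : Fin d) :
    InWindow s (y i) := by
  apply inWindow_of_two_mul_abs_lt
  have h1 : |y i| ≤ |z i| + 2 := by
    have := abs_sub_abs_le_abs_sub (y i) (z i)
    linarith [hy i]
  linarith [hz i]

omit [NeZero s] in
/-- Coordinates of `± e_μ`, `e_μ − e_ν` are at most `2` in absolute value (in fact `≤ 1`). [folklore] -/
theorem abs_unitVec_sub_le (μ ν i : Fin d) : |(unitVec μ - unitVec ν : Fin d → ℤ) i| ≤ 2 := by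
  simp only [Pi.sub_apply, unitVec_apply]
  split_ifs <;> norm_num

/-- `C_{νμ}` READ THROUGH THE RESIDUE MAP on the shrunk window: `ddCorr ν μ (siteOf z) = zddCorr ν μ z` when
`2|z_i| + 4 < s`. [folklore] -/
theorem ddCorr_siteOf (ν μ : Fin d) {z : Fin d → ℤ} (hz : ∀ i, 2 * |z i| + 4 < (s : ℤ)) :
    ddCorr ν μ (siteOf d s z) = zddCorr ν μ z := by
  have w1 : ∀ i, InWindow s ((z + unitVec μ - unitVec ν) i) :=
    inWindow_of_near hz fun i => by
      rw [show (z + unitVec μ - unitVec ν) i - z i = (unitVec μ - unitVec ν : Fin d → ℤ) i from by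
        simp only [Pi.add_apply, Pi.sub_apply]; ring]
      exact abs_unitVec_sub_le μ ν i
  have w2 : ∀ i, InWindow s ((z - unitVec ν) i) :=
    inWindow_of_near hz fun i => by
      rw [show (z - unitVec ν) i - z i = -(unitVec ν : Fin d → ℤ) i from by simp only [Pi.sub_apply]; ring, abs_neg]
      simp only [unitVec_apply]; split_ifs <;> norm_num
  have w3 : ∀ i, InWindow s ((z + unitVec μ) i) :=
    inWindow_of_near hz fun i => by
      rw [show (z + unitVec μ) i - z i = (unitVec μ : Fin d → ℤ) i from by simp only [Pi.add_apply]; ring]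
      simp only [unitVec_apply]; split_ifs <;> norm_num
  have w4 : ∀ i, InWindow s (z i) := inWindow_of_near hz fun i => by simp
  have e1 : siteOf d s z + torusUnitVec μ - torusUnitVec ν = siteOf d s (z + unitVec μ - unitVec ν) := by
    rw [siteOf_sub, siteOf_add, siteOf_unitVec]
    rw [siteOf_unitVec]
  have e2 : siteOf d s z - torusUnitVec ν = siteOf d s (z - unitVec ν) := by rw [siteOf_sub, siteOf_unitVec]
  have e3 : siteOf d s z + torusUnitVec μ = siteOf d s (z + unitVec μ) := by rw [siteOf_add, siteOf_unitVec]
  unfold ddCorr zddCorr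
  rw [e1, e2, e3, delta0_siteOf w1, delta0_siteOf w2, delta0_siteOf w3, delta0_siteOf w4]

/-- **THE TORUS MAXWELL KERNEL READ THROUGH `siteOf` IS THE `ℤ^d` MAXWELL KERNEL** on the window shrunk by the range:
`maxwellKernel d s μ ν (siteOf d s z) = maxwellKernelZ d μ ν z` whenever `2|z_i| + 4 < s` for all `i`. [folklore] -/
theorem maxwellKernel_siteOf (μ ν : Fin d) {z : Fin d → ℤ} (hz : ∀ i, 2 * |z i| + 4 < (s : ℤ)) :
    maxwellKernel d s μ ν (siteOf d s z) = maxwellKernelZ d μ ν z := by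
  rw [maxwellKernel_apply, maxwellKernelZ_apply]
  simp only [ddCorr_siteOf _ _ hz]

end Window

/-! ## §3 The infinite-volume limit: eventual equality -/

section Limit

variable {side : ℕ → ℕ} [∀ t, NeZero (side t)]

omit [∀ t, NeZero (side t)] in
/-- Exhaustion with a margin: along sides `side t → ∞`, every fixed `x ∈ ℤ^d` eventually satisfies
`2|x_i| + 4 < side t` for all `i`. [folklore] -/
theorem eventually_deep (hside : Tendsto side atTop atTop) (x : Fin d → ℤ) :
    ∀ᶠ t in atTop, ∀ i, 2 * |x i| + 4 < (side t : ℤ) := by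
  refine eventually_all.mpr fun i => ?_
  filter_upwards [hside.eventually_gt_atTop (2 * |x i| + 4).toNat] with t ht
  have h₁ : 2 * |x i| + 4 ≤ ((2 * |x i| + 4).toNat : ℤ) := Int.self_le_toNat _
  have h₂ : ((2 * |x i| + 4).toNat : ℤ) < (side t : ℤ) := by exact_mod_cast ht
  exact lt_of_le_of_lt h₁ h₂

/-- Eventually in the volume the torus Maxwell kernel at the residue of `x` EQUALS the `ℤ^d` kernel at `x`. [folklore] -/
theorem eventuallyEq_maxwellKernel_siteOf (hside : Tendsto side atTop atTop) (μ ν : Fin d) (x : Fin d → ℤ) :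
    ∀ᶠ t in atTop, maxwellKernel d (side t) μ ν (siteOf d (side t) x) = maxwellKernelZ d μ ν x := by
  filter_upwards [eventually_deep hside x] with t ht
  exact maxwellKernel_siteOf μ ν ht

/-- **THE `ℤ^d` MAXWELL KERNEL IS THE INFINITE-VOLUME LIMIT OF THE TORUS MAXWELL KERNELS** (pv25's (1.21) predicate,
discharged for the witness): along any sides `side t → ∞`, `maxwellKernel d (side t) μ ν (x mod side t) →
maxwellKernelZ d μ ν x` — the sequence is eventually constant. [folklore] -/
theorem isInfiniteVolumeLimit_maxwellKernel (hside : Tendsto side atTop atTop) :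
    IsInfiniteVolumeLimit side (fun t => maxwellKernel d (side t)) (maxwellKernelZ d) := by
  intro μ ν x
  have h : (fun t => maxwellKernel d (side t) μ ν (siteOf d (side t) x)) =ᶠ[atTop] fun _ => maxwellKernelZ d μ ν x :=
    eventuallyEq_maxwellKernel_siteOf hside μ ν x
  exact tendsto_const_nhds.congr' h.symm

end Limit

/-! ## §4 Volume-uniform finite-range decay -/

section Decay

variable {s : ℕ} [NeZero s]

/-- **THE SYMMETRIC REPRESENTATIVE IS THE SHORTEST**: `|symmRep s (k mod s)| ≤ |k|` for every integer `k` and every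
period `s ≥ 1`. [folklore] -/
theorem abs_symmRep_intCast_le (k : ℤ) : |symmRep s (k : ZMod s)| ≤ |k| := by
  rcases le_or_gt |symmRep s (k : ZMod s)| |k| with h | h
  · exact h
  · have h2 := two_mul_abs_symmRep_le s (k : ZMod s)
    have hk : InWindow s k := inWindow_of_two_mul_abs_lt (by linarith)
    rw [symmRep_intCast hk] at h
    exact absurd h (lt_irrefl _)

/-- The window coordinates of a residue vector are no longer than any integer lift:
`|windowMap (siteOf y)|₁ ≤ |y|₁`. [folklore] -/
theorem l1_windowMap_siteOf_le (y : Fin d → ℤ) :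
    B12Sec2to5.l1 (windowMap d s (siteOf d s y)) ≤ B12Sec2to5.l1 y := by
  unfold B12Sec2to5.l1
  refine Finset.sum_le_sum fun i _ => ?_
  have h := abs_symmRep_intCast_le (s := s) (y i)
  have h' : ((|symmRep s (y i : ZMod s)| : ℤ) : ℝ) ≤ ((|y i| : ℤ) : ℝ) := by exact_mod_cast h
  simpa [windowMap, siteOf, Int.cast_abs] using h'

omit [NeZero s] in
/-- `|e_μ|₁ = 1`. [folklore] -/
theorem l1_unitVec (μ : Fin d) : B12Sec2to5.l1 (unitVec μ : Fin d → ℤ) = 1 := by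
  unfold B12Sec2to5.l1
  have h : ∀ i : Fin d, |((unitVec μ i : ℤ) : ℝ)| = if i = μ then 1 else 0 := by
    intro i; by_cases hi : i = μ <;> simp [hi]
  simp only [h, Finset.sum_ite_eq', Finset.mem_univ, if_true]

omit [NeZero s] in
/-- `|−y|₁ = |y|₁`. [folklore] -/
theorem l1_neg' (y : Fin d → ℤ) : B12Sec2to5.l1 (-y) = B12Sec2to5.l1 y := by
  simp [B12Sec2to5.l1]

omit [NeZero s] in
/-- `|y − z|₁ ≤ |y|₁ + |z|₁`. [folklore] -/
theorem l1_sub_le (y z : Fin d → ℤ) : B12Sec2to5.l1 (y - z) ≤ B12Sec2to5.l1 y + B12Sec2to5.l1 z := by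
  unfold B12Sec2to5.l1
  rw [← Finset.sum_add_distrib]
  refine Finset.sum_le_sum fun i _ => ?_
  simp only [Pi.sub_apply, Int.cast_sub]
  exact abs_sub _ _

omit [NeZero s] in
/-- `|0|₁ = 0`. [folklore] -/
theorem l1_zero' : B12Sec2to5.l1 (0 : Fin d → ℤ) = 0 := by
  simp [B12Sec2to5.l1]

/-- **A DELTA SUPPORTED AT A SHORT VECTOR DECAYS**: if `|v|₁ ≤ 2` then
`δ_T(x − siteOf v) ≤ e^{2δ} e^{−δ |windowMap x|₁}` for every torus point `x` and every `δ ≥ 0` (at the one point where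
the delta is `1`, `x = siteOf v` has window size `≤ |v|₁ ≤ 2`). [folklore] -/
theorem delta0_sub_siteOf_le {δ : ℝ} (hδ : 0 ≤ δ) (x : Beta.Site d s) {v : Fin d → ℤ} (hv : B12Sec2to5.l1 v ≤ 2) :
    delta0 (x - siteOf d s v) ≤ Real.exp (2 * δ) * Real.exp (-δ * B12Sec2to5.l1 (windowMap d s x)) := by
  unfold delta0
  split_ifs with h
  · have hx : x = siteOf d s v := sub_eq_zero.mp h
    have hl : B12Sec2to5.l1 (windowMap d s x) ≤ 2 := by
      rw [hx]; exact (l1_windowMap_siteOf_le v).trans hv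
    rw [← Real.exp_add]
    apply Real.one_le_exp
    nlinarith
  · positivity

omit [NeZero s] in
/-- `0 ≤ δ_T`. [folklore] -/
theorem delta0_nonneg' (u : Beta.Site d s) : 0 ≤ delta0 u := by
  unfold delta0; split_ifs <;> norm_num

/-- The four deltas of `C_{νμ}(x)` written as `δ_T(x − siteOf v)` with `|v|₁ ≤ 2`, and the resulting bound
`|C_{νμ}(x)| ≤ 4 e^{2δ} e^{−δ|windowMap x|₁}`. [folklore] -/
theorem abs_ddCorr_le {δ : ℝ} (hδ : 0 ≤ δ) (ν μ : Fin d) (x : Beta.Site d s) :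
    |ddCorr ν μ x| ≤ 4 * (Real.exp (2 * δ) * Real.exp (-δ * B12Sec2to5.l1 (windowMap d s x))) := by
  set E := Real.exp (2 * δ) * Real.exp (-δ * B12Sec2to5.l1 (windowMap d s x)) with hE
  have e1 : x + torusUnitVec μ - torusUnitVec ν = x - siteOf d s (unitVec ν - unitVec μ) := by
    rw [siteOf_sub, siteOf_unitVec, siteOf_unitVec]; abel
  have e2 : x - torusUnitVec ν = x - siteOf d s (unitVec ν) := by rw [siteOf_unitVec]
  have e3 : x + torusUnitVec μ = x - siteOf d s (-unitVec μ) := by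
    rw [siteOf_neg, siteOf_unitVec]; abel
  have e4 : x = x - siteOf d s (0 : Fin d → ℤ) := by rw [siteOf_zero, sub_zero]
  have b1 : delta0 (x + torusUnitVec μ - torusUnitVec ν) ≤ E := by
    rw [e1]; refine delta0_sub_siteOf_le hδ x ?_
    calc B12Sec2to5.l1 (unitVec ν - unitVec μ : Fin d → ℤ)
        ≤ B12Sec2to5.l1 (unitVec ν : Fin d → ℤ) + B12Sec2to5.l1 (unitVec μ : Fin d → ℤ) := l1_sub_le _ _
      _ = 2 := by rw [l1_unitVec, l1_unitVec]; norm_num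
  have b2 : delta0 (x - torusUnitVec ν) ≤ E := by
    rw [e2]; exact delta0_sub_siteOf_le hδ x (by rw [l1_unitVec]; norm_num)
  have b3 : delta0 (x + torusUnitVec μ) ≤ E := by
    rw [e3]; exact delta0_sub_siteOf_le hδ x (by rw [l1_neg', l1_unitVec]; norm_num)
  have b4 : delta0 x ≤ E := by
    rw [e4]; exact delta0_sub_siteOf_le hδ _ (by rw [l1_zero']; norm_num)
  have n1 := delta0_nonneg' (x + torusUnitVec μ - torusUnitVec ν)
  have n2 := delta0_nonneg' (x - torusUnitVec ν)
  have n3 := delta0_nonneg' (x + torusUnitVec μ)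
  have n4 := delta0_nonneg' x
  rw [ddCorr, abs_le]
  constructor <;> linarith

/-- **THE TORUS MAXWELL KERNEL HAS FINITE RANGE, UNIFORMLY IN THE VOLUME**: for every period `s ≥ 1`, every `δ ≥ 0`
and every torus point `x`, `|maxwellKernel d s μ ν x| ≤ 8(d+1) e^{2δ} e^{−δ |windowMap x|₁}`. [folklore] -/
theorem abs_maxwellKernel_le {δ : ℝ} (hδ : 0 ≤ δ) (μ ν : Fin d) (x : Beta.Site d s) :
    |maxwellKernel d s μ ν x|
      ≤ 8 * (d + 1) * Real.exp (2 * δ) * Real.exp (-δ * B12Sec2to5.l1 (windowMap d s x)) := by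
  set E := Real.exp (2 * δ) * Real.exp (-δ * B12Sec2to5.l1 (windowMap d s x)) with hE
  have hE0 : 0 ≤ E := by positivity
  have hdiag : |(if μ = ν then ∑ κ, ddCorr κ κ x else 0 : ℝ)| ≤ d * (4 * E) := by
    split_ifs
    · calc |∑ κ, ddCorr κ κ x| ≤ ∑ κ : Fin d, |ddCorr κ κ x| := Finset.abs_sum_le_sum_abs _ _
        _ ≤ ∑ _κ : Fin d, 4 * E := Finset.sum_le_sum fun κ _ => abs_ddCorr_le hδ κ κ x
        _ = d * (4 * E) := by simp
    · rw [abs_zero]; positivity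
  have hoff := abs_ddCorr_le hδ ν μ x
  rw [maxwellKernel_apply, abs_mul, abs_two]
  calc 2 * |(if μ = ν then ∑ κ, ddCorr κ κ x else 0) - ddCorr ν μ x|
      ≤ 2 * (d * (4 * E) + 4 * E) := by
        gcongr
        exact (abs_sub _ _).trans (add_le_add hdiag hoff)
    _ = 8 * (d + 1) * Real.exp (2 * δ) * Real.exp (-δ * B12Sec2to5.l1 (windowMap d s x)) := by
        rw [hE]; ring

end Decay

section UniformDecay

variable (side : ℕ → ℕ) [∀ t, NeZero (side t)]

/-- **`UniformDecay` DISCHARGED FOR THE WITNESS** (pv01's located unprinted input of G-beta-4, here a theorem about an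
explicit kernel): for EVERY sequence of sides and every `δ ≥ 0`,
`UniformDecay side (fun t => maxwellKernel d (side t)) (8(d+1)e^{2δ}) δ`. [folklore] -/
theorem uniformDecay_maxwellKernel {δ : ℝ} (hδ : 0 ≤ δ) :
    UniformDecay side (fun t => maxwellKernel d (side t)) (8 * (d + 1) * Real.exp (2 * δ)) δ :=
  fun _ μ ν x => abs_maxwellKernel_le hδ μ ν x

end UniformDecay

/-! ## §5 Assembly: every hypothesis of `PolarizationLimit.secondMoment_nonneg_of_limit` discharged -/

section Assembly

variable {side : ℕ → ℕ} [∀ t, NeZero (side t)]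

/-- **NON-VACUITY OF THE SIGN ASSEMBLY (k4)**: `PolarizationLimit.secondMoment_nonneg_of_limit` applied with EVERY
hypothesis discharged — sides `→ ∞` (the only remaining parameter), the (1.21) limit predicate
(`isInfiniteVolumeLimit_maxwellKernel`), volume-uniform decay (`uniformDecay_maxwellKernel`, `δ = 1`), and torus Ward /
PSD / reflection covariance at EVERY volume ((k5)'s `maxwellKernel_hypotheses`) — gives
`0 ≤ Σ_z Π^ℤ_{αβ}(z) z_α z_β` for `α ≠ β`. [folklore] -/
theorem secondMoment_maxwellKernelZ_nonneg_of_limit (hside : Tendsto side atTop atTop) {α β : Fin d} (hαβ : α ≠ β) :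
    0 ≤ B12Beta.secondMoment (maxwellKernelZ d) α β :=
  secondMoment_nonneg_of_limit hside (isInfiniteVolumeLimit_maxwellKernel hside) one_pos
    (uniformDecay_maxwellKernel side zero_le_one)
    (Eventually.of_forall fun t => (maxwellKernel_hypotheses d (side t)).1)
    (Eventually.of_forall fun t => (maxwellKernel_hypotheses d (side t)).2.2.2)
    (Eventually.of_forall fun t => (maxwellKernel_hypotheses d (side t)).2.1) hαβ

/-- **THE TORUS SECOND MOMENTS CONVERGE TO THE `ℤ^d` SECOND MOMENT** (pv01's `tendsto_torusSecondMoment`, hypotheses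
discharged): `Σ_{x∈T_t} Π_{μν}(x) x̂_μ x̂_ν → Σ_{z∈ℤ^d} Π^ℤ_{μν}(z) z_μ z_ν` along any sides `→ ∞`. [folklore] -/
theorem tendsto_torusSecondMoment_maxwellKernel (hside : Tendsto side atTop atTop) (μ ν : Fin d) :
    Tendsto (fun t => torusSecondMoment (maxwellKernel d (side t)) μ ν) atTop
      (𝓝 (B12Beta.secondMoment (maxwellKernelZ d) μ ν)) :=
  tendsto_torusSecondMoment hside (isInfiniteVolumeLimit_maxwellKernel hside) one_pos
    (uniformDecay_maxwellKernel side zero_le_one) μ ν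

end Assembly

/-! ## §6 The `ℤ^d` predicates of (k3) and the value `β = 2` for the limit kernel, unconditionally -/

section Values

/-- The sides `t + 1 → ∞`. [folklore] -/
theorem tendsto_succ_atTop : Tendsto (fun t : ℕ => t + 1) atTop atTop := tendsto_add_atTop_nat 1

/-- (5.9)-shape for the witness: `WardTransversal (maxwellKernelZ d)`. [folklore] -/
theorem wardTransversal_maxwellKernelZ : WardTransversal (maxwellKernelZ d) :=
  wardTransversal_of_limit (isInfiniteVolumeLimit_maxwellKernel (side := fun t => t + 1) tendsto_succ_atTop)
    (Eventually.of_forall fun t => (maxwellKernel_hypotheses d (t + 1)).1)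

/-- (5.7)-shape for the witness: `AxisReflectionCovariant (maxwellKernelZ d)`. [folklore] -/
theorem axisReflectionCovariant_maxwellKernelZ : AxisReflectionCovariant (maxwellKernelZ d) :=
  axisReflectionCovariant_of_limit (isInfiniteVolumeLimit_maxwellKernel (side := fun t => t + 1) tendsto_succ_atTop)
    (Eventually.of_forall fun t => (maxwellKernel_hypotheses d (t + 1)).2.1)

/-- (5.8)-shape for the witness: `IndexSymmetric (maxwellKernelZ d)`. [folklore] -/
theorem indexSymmetric_maxwellKernelZ : IndexSymmetric (maxwellKernelZ d) :=
  indexSymmetric_of_limit (isInfiniteVolumeLimit_maxwellKernel (side := fun t => t + 1) tendsto_succ_atTop)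
    (Eventually.of_forall fun t => (maxwellKernel_hypotheses d (t + 1)).2.2.1)

/-- Positive semi-definiteness of the `ℤ^d` convolution form of the witness: `ConvPSD (maxwellKernelZ d)`. [folklore] -/
theorem convPSD_maxwellKernelZ : ConvPSD (maxwellKernelZ d) :=
  convPSD_of_limit (isInfiniteVolumeLimit_maxwellKernel (side := fun t => t + 1) tendsto_succ_atTop)
    (Eventually.of_forall fun t => (maxwellKernel_hypotheses d (t + 1)).2.2.2)

/-- (5.10)-shape for the witness: `Decay510 (maxwellKernelZ d μ ν) (8(d+1)e^{2δ}) δ` for every `δ ≥ 0`. [folklore] -/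
theorem decay510_maxwellKernelZ {δ : ℝ} (hδ : 0 ≤ δ) (μ ν : Fin d) :
    B12Sec2to5.Decay510 (maxwellKernelZ d μ ν) (8 * (d + 1) * Real.exp (2 * δ)) δ :=
  decay510_of_isInfiniteVolumeLimit (side := fun t => t + 1) tendsto_succ_atTop
    (isInfiniteVolumeLimit_maxwellKernel tendsto_succ_atTop) (uniformDecay_maxwellKernel _ hδ) μ ν

/-- All moments of the witness converge absolutely: `MomentSummable (maxwellKernelZ d) n`. [folklore] -/
theorem momentSummable_maxwellKernelZ (n : ℕ) : MomentSummable (maxwellKernelZ d) n :=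
  momentSummable_of_decay510 one_pos (fun μ ν => decay510_maxwellKernelZ zero_le_one μ ν) n

/-- **THE SECOND MOMENT OF THE INFINITE-VOLUME WITNESS IS `2`**: `Σ_{z∈ℤ^d} Π^ℤ_{μν}(z) z_μ z_ν = 2` for `μ ≠ ν` — READ
OFF the finite-volume numbers `torusSecondMoment (maxwellKernel d s) μ ν = 2` (`s ≥ 3`, (k5)) through the dictionary
(`tendsto_torusSecondMoment_maxwellKernel`) by uniqueness of limits.  In particular the conclusion `0 ≤ β` of
`secondMoment_maxwellKernelZ_nonneg_of_limit` holds STRICTLY. [folklore] -/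
theorem secondMoment_maxwellKernelZ {μ ν : Fin d} (hμν : μ ≠ ν) :
    B12Beta.secondMoment (maxwellKernelZ d) μ ν = 2 := by
  have h1 := tendsto_torusSecondMoment_maxwellKernel (d := d) (side := fun t => t + 1) tendsto_succ_atTop μ ν
  have h2 : Tendsto (fun t : ℕ => torusSecondMoment (maxwellKernel d (t + 1)) μ ν) atTop (𝓝 2) := by
    refine (tendsto_const_nhds (x := (2 : ℝ))).congr' ?_
    filter_upwards [eventually_ge_atTop 2] with t ht
    exact (torusSecondMoment_maxwellKernel (by omega) hμν).symm
  exact tendsto_nhds_unique h1 h2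

/-- … hence strictly positive. [folklore] -/
theorem secondMoment_maxwellKernelZ_pos {μ ν : Fin d} (hμν : μ ≠ ν) :
    0 < B12Beta.secondMoment (maxwellKernelZ d) μ ν := by
  rw [secondMoment_maxwellKernelZ hμν]; norm_num

end Values

end Literature.MathematicalPhysics.QuantumFieldTheory.Balaban1983to89.Beta.PolarizationWitnessZd
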